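import Summits.Schanuel.Schanuel.Theorems.RootDecomp1KParamThueMahler03

/-!
# RootDecomp1KRunge — lens 1, generation 57, NODE 18 «RUNGE ON THE K-LINE» (2-adic Runge's method at x = ∞; RULE K-R48 payable clause; CLAIM L2698, PRICE L2701, K-R49) — part 1 (RootDecomp1KRunge01): §0–§2

(lens-1 g57 NODE 18 HOME kernel K = HOME/decomp-schanuel-lens-1/g57/Runge.lean 42801ffe…, 1394 l, 113 thm + structure RungeCert + integer-table defs, imports tree …RootDecomp1KParamThueMahler03 ONLY = the port of node 17 (no Literature import, no fact def, no private; two local `set_option maxHeartbeats … in` as in K); Probe / Ctrl0 / Ctrl + NODE-g57.md + SHA256SUMS; CLAIM L2698, census LIVENESS-v8 L2699 (of record L2701) / LIVENESS-v9 L2703, writer CHECK NOTE L2700 (certificate arithmetic reproduces), crit g10 EX-ANTE PRICE L2701 (ONE THEOREM ×1 for (A) engine + (B) binder discharge thinFibreAt_M17P + (C) the family RW jointly iff CHECKLIST K-g57 (1)–(10); RULE K-R49 pre-announced), NODE L2704, critic VERDICT L2711 (crit g10): CLEARED — THEOREM ×1 (joint (A) engine + (B) binder discharge + (C) the family RW),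 ex-ante PRICE L2701 met 10/10, prong «infinite class of positive-genus re-amended-frontier pairs made unconditional» (K-R48 PAYABLE), rung 0; RULE K-R49 FIXED (toolkit of record ∪= 2-adic Runge certificates — the `RungeCert k c` engine `thinFibreAt_of_rungeCert`; FRONTIER re-amended by «NOT Runge-certifiable», Runge-certifiable(m₀,P) := ((deg topX < natDegree ∨ topX ℚ-reducible) ∧ eTop+1 ≤ m₀) ∨ natDegree < m₀·xdeg; standing open-territory witness W4 (census TM33)); PORT GO exactly as STAGING NOTE 8 L2708 with the port edits (a)–(d) SANCTIONED; writer RE-CHECK L2709. Port by census-1 gen 22 as `RootDecomp1KRunge01–06` (`--supports stmt-Schanuel-33364`; no census credit): 01 = §0 small facts (local copies of private tree lemmas), §1 integer coefficient tables `ev` / `ev₁` / `tabAbs`, §2 the level polynomial `ptilde` vanishing at (t_N, r) (`tQ N = 2^N!/p_N`); 02 = §3 THE 2-ADIC RUNGE ESTIMATE `runge_small` (‖Φ(t_N, r)‖₂ ≤ K·2^(−M·N!)), §4 the integer `zInt` (product formula), §5 the arithmetic endgame; 03 = §6 `structure RungeCert k c` (integral two-polynomial Runge certificate) and THE ENGINE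 **`thinFibreAt_of_rungeCert`**; 04 = §7 the member M17P: tables `m17G … m17rho`, `m17Cert : RungeCert 2 m17C`, **`thinFibreAt_M17P_runge : 2 ≤ m₀ → ThinFibreAt m₀ M17P` HYPOTHESIS-FREE** (the tree's `thinFibreAt_M17P (hS : PadicSubspace)` loses its binder); 05 = §8 the infinite class `RW w = xPolyP 5 (rwC w)` (deg w ≤ 3), the w-free certificate `rwCert`, **`thinFibreAt_RW`**, members `RW1/RW2/RW3`; 06 = §9 TERRITORY certificates by tree names (section Territory). PORT EDITS (head dry-run near-duplicate notes resolved before filing, as in the node-14/15 ports): TWO delete-for-twin in §0 — K's `partialSum_two_runge` (≡ `RootDecomp1KLevelFinite.lac_partialSum_two`, LevelFinite12) and K's `norm_two_runge` (≡ `RootDecomp1KLocalExponent.norm_two_Cp`, LocalExponent01), each single use re-pointed to the tree name; TWO privatisations with file-local copies where a later part uses them — K's `norm_intCast_le_one_runge` and `norm_intCast_two_runge` (near-duplicates of BirchSwinnertonDyer decls); 62 one-line docstrings on undocumented computation lemmas (statements quoted); K's two local `set_option maxHeartbeats N in` kept verbatim; nothing else; provenance doc blocks + continuation headers = K's own open-lines;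 statements and proofs VERBATIM. Rung 0 — nothing here proves Schanuel, 33364, 33363, 31077 or ThinFibre 2; everything HYPOTHESIS-FREE.)
-/

/-!
# RootDecomp1KRunge — lens 1, generation 57, node 18 «RUNGE ON THE K-LINE»

2-adic RUNGE'S METHOD for the curves `P = Σ_{j ≤ k} x^j c_j(Y)` on the levels `x = s_N = p_N / 2^{N!}`.
With `t = 1/x`, `P~(t, Y) = Σ_j c_j(Y) t^{k-j}` and `t_N = 2^{N!}/p_N` (`‖t_N‖₂ = 2^{-N!}`), an INTEGRAL RUNGE
CERTIFICATE consists of integer coefficient tables `G, H, R, V, E, Φ` and non-zero integers `Dg, h₀, DΦ` with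
`Dg · P~ = G · H + t^M · R`, `H(0, Y) = h₀`, `DΦ · Φ = V(t) · G + t^M · E`, `deg_t Φ ≤ a`, `deg_Y Φ ≤ b`,
`(M - a) · 2 ≥ b + 1` (two such `Φ₁, Φ₂` with `A · Φ₁ + B · Φ₂ = ρ(t)`, `ρ ≠ 0`).  At a level point `(t_N, r)` with
`‖r‖₂` bounded the factor `H` is a 2-adic unit, so `‖G(t_N, r)‖₂ ≤ K 2^{-MN!}` and `‖Φ(t_N, r)‖₂ ≤ K 2^{-MN!}`; the
integer `Z = Σ Φ_ij p_N^{a-i} 2^{iN!} num(r)^j den(r)^{b-j}` then has `‖Z‖₂ ≤ K 2^{-MN!}` and `|Z| ≤ K' 2^{aN!} den(r)^b`,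
so (product formula) `Z = 0` or `den(r)^b ≥ 2^{(M-a)N!}/K''`, and the latter contradicts the negated clause
`den(r)^{m₀ N} ≤ C 2^{(N+1)!}` for large `N` as soon as `(M - a) m₀ ≥ b + 1`; `Z₁ = Z₂ = 0` puts `t_N` among the roots
of `ρ`: finitely many levels.  The far branch (`‖r‖₂` large, the point `(∞, ∞)` of order `e`) is the tree's
`near_root_or_at_infinity` / `infinity_arith` (`e + 1 ≤ m₀`).  NO Diophantine input (no Ridout / Subspace /
Thue–Mahler / Gauss), NO binder.

Headlines: `thinFibreAt_of_rungeCert` (the engine), `thinFibreAt_M17P_runge : 2 ≤ m₀ → ThinFibreAt m₀ M17P`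
HYPOTHESIS-FREE (the tree's `thinFibreAt_M17P` carries `(hS : PadicSubspace)`), and the infinite class
`thinFibreAt_RW : ∀ w, 2 ≤ m₀ → ThinFibreAt m₀ (RW w)` (`RW w = x⁵(Y²−17) + x⁴(Y³+Y+1) + x³Y + x²(Y+1) + x(Y³−2) + w(Y)`,
every `w ∈ ℤ[Y]` of degree `≤ 3`, ONE `w`-free certificate).
-/

noncomputable section

namespace Summit.Schanuel.Schanuel.Theorems.RootDecomp1KRunge

open Polynomial LiouvilleNumber
open scoped Nat
open Summit.Schanuel.Schanuel.Theorems.RootDecomp1KTwoBaseCell (psNumer partialSum_eq_psNumer_div coprime_psNumer)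
open Summit.Schanuel.Schanuel.Theorems.RootDecomp1KRelLiouvilleCell (partialSum_two_strictMono
  partialSum_two_lt_liouvilleNumber)
open Summit.Schanuel.Schanuel.Theorems.RootDecomp1KDegreeLadder
open Summit.Schanuel.Schanuel.Theorems.RootDecomp1KXLinearCore
open Summit.Schanuel.Schanuel.Theorems.RootDecomp1KXLinear
open Summit.Schanuel.Schanuel.Theorems.RootDecomp1KXLinearII
open Summit.Schanuel.Schanuel.Theorems.RootDecomp1KXTop
open Summit.Schanuel.Schanuel.Theorems.RootDecomp1KSubspaceBranch

/-! ### §0 Small facts (local copies of private tree lemmas) -/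

/-- `‖(z : \overline{ℚ₂})‖ ≤ 1` for integers. -/
private theorem norm_intCast_le_one_runge (z : ℤ) : ‖(z : PadicAlgCl 2)‖ ≤ 1 := by
  have h1 : (z : PadicAlgCl 2) = algebraMap ℚ_[2] (PadicAlgCl 2) (z : ℚ_[2]) := (map_intCast _ z).symm
  rw [h1, PadicAlgCl.norm_extends]
  exact Padic.norm_int_le_one z

/-- `|m|₂ = 2^{−v₂(m)}` for a non-zero integer `m`. -/
private theorem norm_intCast_two_runge {m : ℤ} (hm : m ≠ 0) :
    ‖(m : PadicAlgCl 2)‖ = (2 : ℝ) ^ (-(padicValInt 2 m : ℤ)) := by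
  have h1 : (m : PadicAlgCl 2) = algebraMap ℚ_[2] (PadicAlgCl 2) (m : ℚ_[2]) := (map_intCast _ m).symm
  rw [h1, PadicAlgCl.norm_extends, Padic.norm_eq_zpow_neg_valuation (by exact_mod_cast hm),
    Padic.valuation_intCast]
  norm_num

/-- `‖(z : \overline{ℚ₂})‖ ≤ |z|` for integers. -/
theorem norm_intCast_le_abs_runge (z : ℤ) : ‖(z : PadicAlgCl 2)‖ ≤ |(z : ℝ)| := by
  rcases eq_or_ne z 0 with rfl | hz
  · simp
  · exact (norm_intCast_le_one_runge z).trans (by exact_mod_cast Int.one_le_abs hz)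

/-- `0 < p_N`. -/
theorem psNumer_pos_runge (N : ℕ) : 0 < psNumer 2 N := by
  unfold psNumer
  exact Finset.sum_pos (fun i _ => pow_pos two_pos _) (Finset.nonempty_range_iff.mpr (Nat.succ_ne_zero N))

/-- the level parameter `t_N = 2^{N!}/p_N ∈ ℚ` (`= 1/s_N`). -/
def tQ (N : ℕ) : ℚ := (2 : ℚ) ^ N ! / (psNumer 2 N : ℚ)

/-- `(t_N : ℝ) = 1 / s_N`. -/
theorem tQ_cast (N : ℕ) : ((tQ N : ℚ) : ℝ) = 1 / partialSum 2 N := by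
  rw [RootDecomp1KLevelFinite.lac_partialSum_two, tQ]
  have hp : (psNumer 2 N : ℝ) ≠ 0 := by exact_mod_cast (psNumer_pos_runge N).ne'
  push_cast
  field_simp

/-- `N ↦ t_N` is injective. -/
theorem tQ_injective : Function.Injective tQ := by
  intro N N' h
  have h' : ((tQ N : ℚ) : ℝ) = ((tQ N' : ℚ) : ℝ) := by rw [h]
  rw [tQ_cast, tQ_cast, one_div, one_div, inv_inj] at h'
  exact partialSum_two_strictMono.injective h'

/-- `(t_N : \overline{ℚ₂}) = 2^{N!} / p_N`. -/
theorem tQ_castTwo (N : ℕ) :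
    ((tQ N : ℚ) : PadicAlgCl 2) = (2 : PadicAlgCl 2) ^ N ! / (psNumer 2 N : PadicAlgCl 2) := by
  rw [tQ]; push_cast; rfl

/-- `‖t_N‖₂ = 2^{-N!}` (`N ≥ 3`). -/
theorem norm_tN {N : ℕ} (hN : 3 ≤ N) :
    ‖(2 : PadicAlgCl 2) ^ N ! / (psNumer 2 N : PadicAlgCl 2)‖ = (1 / 2 : ℝ) ^ N ! := by
  rw [norm_div, norm_pow, RootDecomp1KLocalExponent.norm_two_Cp, norm_psNumer hN, div_one]

/-- the levels `N` with `ρ(t_N) = 0` are finitely many (`ρ ≠ 0`). -/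
theorem rho_levels_finite (ρ : ℤ[X]) (hρ : ρ ≠ 0) : {N : ℕ | aeval (tQ N) ρ = 0}.Finite := by
  classical
  set ρQ : ℚ[X] := ρ.map (Int.castRingHom ℚ) with hρQ
  have hρQ0 : ρQ ≠ 0 := by
    rw [hρQ]
    exact (Polynomial.map_ne_zero_iff (Int.castRingHom ℚ).injective_int).mpr hρ
  refine (Set.Finite.preimage tQ_injective.injOn (ρQ.roots.toFinset.finite_toSet)).subset ?_
  intro N hN
  have hN' : aeval (tQ N) ρ = 0 := hN
  show tQ N ∈ (ρQ.roots.toFinset : Set ℚ)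
  rw [Finset.mem_coe, Multiset.mem_toFinset, mem_roots hρQ0, IsRoot.def, hρQ, eval_map, ← algebraMap_int_eq,
    ← aeval_def]
  exact hN'

/-! ### §1 Integer coefficient tables and their evaluations -/

/-- evaluation of an integer coefficient table: `ev F t y = Σ_{i < dt} Σ_{j < dy} F i j · t^i · y^j`. -/
def ev {dt dy : ℕ} {A : Type*} [CommRing A] (F : Fin dt → Fin dy → ℤ) (t y : A) : A :=
  ∑ i : Fin dt, ∑ j : Fin dy, (F i j : A) * t ^ (i : ℕ) * y ^ (j : ℕ)

/-- evaluation of a one-variable integer table: `ev₁ V t = Σ_{i < d} V i · t^i`. -/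
def ev₁ {d : ℕ} {A : Type*} [CommRing A] (V : Fin d → ℤ) (t : A) : A :=
  ∑ i : Fin d, (V i : A) * t ^ (i : ℕ)

/-- the sum of the absolute values of a table. -/
def tabAbs {dt dy : ℕ} (F : Fin dt → Fin dy → ℤ) : ℝ := ∑ i : Fin dt, ∑ j : Fin dy, |(F i j : ℝ)|

/-- the sum of the absolute values of a one-variable table. -/
def tabAbs₁ {d : ℕ} (V : Fin d → ℤ) : ℝ := ∑ i : Fin d, |(V i : ℝ)|

/-- `{dt dy : ℕ} (F : Fin dt → Fin dy → ℤ) : 0 ≤ tabAbs F`. -/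
theorem tabAbs_nonneg {dt dy : ℕ} (F : Fin dt → Fin dy → ℤ) : 0 ≤ tabAbs F :=
  Finset.sum_nonneg fun _ _ => Finset.sum_nonneg fun _ _ => abs_nonneg _

/-- `{d : ℕ} (V : Fin d → ℤ) : 0 ≤ tabAbs₁ V`. -/
theorem tabAbs₁_nonneg {d : ℕ} (V : Fin d → ℤ) : 0 ≤ tabAbs₁ V :=
  Finset.sum_nonneg fun _ _ => abs_nonneg _

/-- `ev` commutes with the cast `ℚ → \overline{ℚ₂}`. -/
theorem ev_castTwo {dt dy : ℕ} (F : Fin dt → Fin dy → ℤ) (t y : ℚ) :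
    ((ev F t y : ℚ) : PadicAlgCl 2) = ev F (t : PadicAlgCl 2) (y : PadicAlgCl 2) := by
  unfold ev; push_cast; rfl

/-- `‖t^i − 0^i‖ ≤ ‖t‖` for `‖t‖ ≤ 1`. -/
theorem norm_pow_sub_zero_pow_le (t : PadicAlgCl 2) (ht : ‖t‖ ≤ 1) (i : ℕ) :
    ‖t ^ i - 0 ^ i‖ ≤ ‖t‖ := by
  rcases Nat.eq_zero_or_pos i with rfl | hi
  · simp
  · rw [zero_pow hi.ne', sub_zero, norm_pow]
    exact pow_le_of_le_one (norm_nonneg _) ht hi.ne'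

/-- size of `ev F t y` for `‖t‖₂ ≤ 1`: at most `tabAbs F · max(1, ‖y‖₂)^{dy}`. -/
theorem norm_ev_le {dt dy : ℕ} (F : Fin dt → Fin dy → ℤ) {t y : PadicAlgCl 2} (ht : ‖t‖ ≤ 1) :
    ‖ev F t y‖ ≤ tabAbs F * max 1 ‖y‖ ^ dy := by
  have hM1 : (1 : ℝ) ≤ max 1 ‖y‖ := le_max_left _ _
  unfold ev tabAbs
  rw [Finset.sum_mul]
  refine (norm_sum_le _ _).trans (Finset.sum_le_sum fun i _ => ?_)
  rw [Finset.sum_mul]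
  refine (norm_sum_le _ _).trans (Finset.sum_le_sum fun j _ => ?_)
  rw [norm_mul, norm_mul, norm_pow, norm_pow]
  have h1 : ‖t‖ ^ (i : ℕ) ≤ 1 := pow_le_one₀ (norm_nonneg _) ht
  have h2 : ‖y‖ ^ (j : ℕ) ≤ max 1 ‖y‖ ^ dy :=
    (pow_le_pow_left₀ (norm_nonneg _) (le_max_right _ _) _).trans (pow_le_pow_right₀ hM1 j.isLt.le)
  calc ‖(F i j : PadicAlgCl 2)‖ * ‖t‖ ^ (i : ℕ) * ‖y‖ ^ (j : ℕ)
      ≤ |(F i j : ℝ)| * 1 * max 1 ‖y‖ ^ dy :=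
        mul_le_mul (mul_le_mul (norm_intCast_le_abs_runge _) h1 (by positivity) (abs_nonneg _)) h2
          (by positivity) (by positivity)
    _ = |(F i j : ℝ)| * max 1 ‖y‖ ^ dy := by ring

/-- `ev F t y − ev F 0 y` is `O(‖t‖₂)`: at most `‖t‖₂ · tabAbs F · max(1, ‖y‖₂)^{dy}` for `‖t‖₂ ≤ 1`. -/
theorem norm_ev_sub_le {dt dy : ℕ} (F : Fin dt → Fin dy → ℤ) {t y : PadicAlgCl 2} (ht : ‖t‖ ≤ 1) :
    ‖ev F t y - ev F 0 y‖ ≤ ‖t‖ * (tabAbs F * max 1 ‖y‖ ^ dy) := by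
  have hM1 : (1 : ℝ) ≤ max 1 ‖y‖ := le_max_left _ _
  have hsub : ev F t y - ev F 0 y =
      ∑ i : Fin dt, ∑ j : Fin dy, (F i j : PadicAlgCl 2) * (t ^ (i : ℕ) - 0 ^ (i : ℕ)) * y ^ (j : ℕ) := by
    unfold ev
    rw [← Finset.sum_sub_distrib]
    refine Finset.sum_congr rfl fun i _ => ?_
    rw [← Finset.sum_sub_distrib]
    refine Finset.sum_congr rfl fun j _ => ?_
    ring
  rw [hsub]
  unfold tabAbs
  rw [Finset.sum_mul, Finset.mul_sum]
  refine (norm_sum_le _ _).trans (Finset.sum_le_sum fun i _ => ?_)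
  rw [Finset.sum_mul, Finset.mul_sum]
  refine (norm_sum_le _ _).trans (Finset.sum_le_sum fun j _ => ?_)
  rw [norm_mul, norm_mul, norm_pow]
  have h1 : ‖t ^ (i : ℕ) - 0 ^ (i : ℕ)‖ ≤ ‖t‖ := norm_pow_sub_zero_pow_le t ht i
  have h2 : ‖y‖ ^ (j : ℕ) ≤ max 1 ‖y‖ ^ dy :=
    (pow_le_pow_left₀ (norm_nonneg _) (le_max_right _ _) _).trans (pow_le_pow_right₀ hM1 j.isLt.le)
  calc ‖(F i j : PadicAlgCl 2)‖ * ‖t ^ (i : ℕ) - 0 ^ (i : ℕ)‖ * ‖y‖ ^ (j : ℕ)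
      ≤ |(F i j : ℝ)| * ‖t‖ * max 1 ‖y‖ ^ dy :=
        mul_le_mul (mul_le_mul (norm_intCast_le_abs_runge _) h1 (norm_nonneg _) (abs_nonneg _)) h2
          (by positivity) (by positivity)
    _ = ‖t‖ * (|(F i j : ℝ)| * max 1 ‖y‖ ^ dy) := by ring

/-- size of `ev₁ V t` for `‖t‖₂ ≤ 1`. -/
theorem norm_ev₁_le {d : ℕ} (V : Fin d → ℤ) {t : PadicAlgCl 2} (ht : ‖t‖ ≤ 1) : ‖ev₁ V t‖ ≤ tabAbs₁ V := by
  unfold ev₁ tabAbs₁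
  refine (norm_sum_le _ _).trans (Finset.sum_le_sum fun i _ => ?_)
  rw [norm_mul, norm_pow]
  have h1 : ‖t‖ ^ (i : ℕ) ≤ 1 := pow_le_one₀ (norm_nonneg _) ht
  calc ‖(V i : PadicAlgCl 2)‖ * ‖t‖ ^ (i : ℕ) ≤ |(V i : ℝ)| * 1 :=
        mul_le_mul (norm_intCast_le_abs_runge _) h1 (by positivity) (abs_nonneg _)
    _ = |(V i : ℝ)| := mul_one _

/-! ### §2 The level polynomial `P~(t, Y) = Σ_j c_j(Y) t^{k-j}` vanishes at `(t_N, r)` -/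

/-- `P~(t, Y) = Σ_{j ≤ k} c_j(Y) · t^{k - j}` (`= t^k · P(1/t, Y)`). -/
def ptilde (k : ℕ) (c : ℕ → ℤ[X]) {A : Type*} [CommRing A] (t y : A) : A :=
  ∑ j ∈ Finset.range (k + 1), aeval y (c j) * t ^ (k - j)

/-- at a level point: `P~(t_N, r) = 0` in `\overline{ℚ₂}` (`N ≥ 3`). -/
theorem ptilde_level (k : ℕ) (c : ℕ → ℤ[X]) {N : ℕ} (hN : 3 ≤ N) (r : ℚ)
    (hP : bev (xPolyP k c) (partialSum 2 N) r = 0) :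
    ptilde k c ((2 : PadicAlgCl 2) ^ N ! / (psNumer 2 N : PadicAlgCl 2)) (r : PadicAlgCl 2) = 0 := by
  set p : PadicAlgCl 2 := (psNumer 2 N : PadicAlgCl 2) with hpdef
  have hp : p ≠ 0 := by
    intro h
    have h1 := norm_psNumer hN
    rw [← hpdef, h, norm_zero] at h1
    exact zero_ne_one h1
  have hsum : ∑ j ∈ Finset.range (k + 1), p ^ j * 2 ^ ((k - j) * N !) * aeval (r : PadicAlgCl 2) (c j) = 0 := by
    rw [Finset.sum_range_succ, Nat.sub_self, zero_mul, pow_zero, mul_one, hpdef, level_identity k c N r hP]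
    exact add_neg_cancel _
  have hmul : p ^ k * ptilde k c ((2 : PadicAlgCl 2) ^ N ! / p) (r : PadicAlgCl 2) =
      ∑ j ∈ Finset.range (k + 1), p ^ j * 2 ^ ((k - j) * N !) * aeval (r : PadicAlgCl 2) (c j) := by
    unfold ptilde
    rw [Finset.mul_sum]
    refine Finset.sum_congr rfl fun j hj => ?_
    have hjk : j ≤ k := by have := Finset.mem_range.mp hj; omega
    have hpk : p ^ k = p ^ j * p ^ (k - j) := by rw [← pow_add, Nat.add_sub_cancel' hjk]
    calc p ^ k * (aeval (r : PadicAlgCl 2) (c j) * ((2 : PadicAlgCl 2) ^ N ! / p) ^ (k - j))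
        = p ^ j * (aeval (r : PadicAlgCl 2) (c j) * ((2 : PadicAlgCl 2) ^ N !) ^ (k - j)) *
            (p ^ (k - j) / p ^ (k - j)) := by rw [hpk, div_pow]; ring
      _ = p ^ j * 2 ^ ((k - j) * N !) * aeval (r : PadicAlgCl 2) (c j) := by
          rw [div_self (pow_ne_zero _ hp), mul_one, ← pow_mul, mul_comm (N !) (k - j)]; ring
  rw [hsum] at hmul
  exact (mul_eq_zero.mp hmul).resolve_left (pow_ne_zero _ hp)

end Summit.Schanuel.Schanuel.Theorems.RootDecomp1KRunge

end
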